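import Summits.NavierStokesRegularity.NavierStokesRegularity.Theorems.OddMorawetzLocal.Negative.OddMorawetzLocalEvaluatorDefs
import Summits.NavierStokesRegularity.NavierStokesRegularity.Theorems.OddMorawetzOrderThreeIndefiniteCalculus
import HarnessLib

/-!
# Crux `OddMorawetzLocal` (stmt-NavierStokesRegularity-1376) — semantics of the list polynomials `EPoly`

Support file for the refutation skeleton of `OddMorawetzLocal` (line `registered`, lead c1), registered stub
`epoly_semantics` (evaluator soundness, part 1 of 4).  Mathlib `List` / `MvPolynomial.pderiv` API and the tree's
`pev_*` lemmas only; no named facts; nothing is defined.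

The exact evaluator of `OddMorawetzLocalEvaluatorDefs.lean` computes the Morawetz pairing of a cubic jet polynomial
at an explicit polynomial-Gaussian field in the kernel, with sparse list polynomials
`EPoly = List (ℚ × ℕ × ℕ × ℕ)` (coefficient, exponents of `x₀, x₁, x₂`).  This file is the algebraic half of its
soundness: the interpretation `EPoly.toP3 : EPoly → P3 = MvPolynomial (Fin 3) ℝ` is a "homomorphism" from the list
operations to the tree's polynomial-Gaussian vocabulary of `OddMorawetzDefs.lean`:

* `pev_toP3`      — the real value `EPoly.eval p x` is `pev (toP3 p) x`;
* `toP3_append`, `toP3_smul`, `toP3_mul` — concatenation, scalar multiples, the all-pairs product;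
* `toP3_pderiv`, `toP3_mulX`, `toP3_dg` — the list derivative is `MvPolynomial.pderiv`, `mulX j` is multiplication
  by `X j`, hence the list `EPoly.dg k j` is the tree's conjugated derivative `dg k j = ∂ⱼ − 2k xⱼ`;
* `toP3_collect`, `toP3_norm` — collecting equal exponents and dropping zero coefficients do not change the
  polynomial (`toP3_insertTerm`);
* `toP3_dgList`, `toP3_ejet`, `toP3_eprodJets` — iterated (normalised) conjugated derivatives are the tree's `dgList`,
  jets and products of jets are the expected products;
* `toP3_eEP`      — the Euler–Lagrange list `eEP p P a` is
  `Σ_{(c, m) ∈ p} Σ_{s : (m_s).1 = a} (−1)^{|(m_s).2|} c · dgList 2 (m_s).2 (Π_{j ≠ s} dgList 1 (m_j).2 (toP3 (P (m_j).1)))`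
  (induction on `p`, the inner fold over the positions generalised to an arbitrary list of positions,
  `toP3_eEP_inner`);
* `toP3_eWP`, `toP3_ediv`, `toP3v_apply` — `eWP` is the tree's `WP (toP3v P)`, `ediv k V` is `Σᵢ dg k i (toP3 (V i))`;

assembled into the registered eight-part conjunction `epoly_semantics`.
-/

noncomputable section

set_option linter.dupNamespace false
set_option autoImplicit false

namespace Summit.NavierStokesRegularity.NavierStokesRegularity.Theorems.OddMorawetz

open MvPolynomial

/-! ### Unfolding `toP3` -/

/-- The empty list is the zero polynomial. -/
@[simp] theorem toP3_nil : EPoly.toP3 [] = 0 := by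
  simp [EPoly.toP3]

/-- `toP3` of `t :: p` is the monomial of `t` plus `toP3 p`. -/
theorem toP3_cons (t : ℚ × ℕ × ℕ × ℕ) (p : EPoly) :
    EPoly.toP3 (t :: p) = C (t.1 : ℝ) * (X 0 ^ t.2.1 * X 1 ^ t.2.2.1 * X 2 ^ t.2.2.2) + EPoly.toP3 p := by
  simp [EPoly.toP3]

/-- A one-term list. -/
theorem toP3_single (t : ℚ × ℕ × ℕ × ℕ) :
    EPoly.toP3 [t] = C (t.1 : ℝ) * (X 0 ^ t.2.1 * X 1 ^ t.2.2.1 * X 2 ^ t.2.2.2) := by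
  rw [toP3_cons, toP3_nil, add_zero]

/-! ### Addition, scalar multiples, products -/

/-- **Concatenation is addition.** -/
theorem toP3_append (p q : EPoly) : EPoly.toP3 (p ++ q) = EPoly.toP3 p + EPoly.toP3 q := by
  simp [EPoly.toP3, List.map_append, List.sum_append]

/-- **Scalar multiples.** -/
theorem toP3_smul (c : ℚ) (p : EPoly) : EPoly.toP3 (EPoly.smul c p) = C (c : ℝ) * EPoly.toP3 p := by
  induction p with
  | nil => simp [EPoly.smul, EPoly.toP3]
  | cons t p ih =>
    have h : EPoly.smul c (t :: p) = (c * t.1, t.2) :: EPoly.smul c p := rfl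
    rw [h, toP3_cons, toP3_cons, ih, mul_add, Rat.cast_mul, map_mul]
    ring

/-- Multiplying every term by a fixed term. -/
private theorem toP3_map_mulTerm (s : ℚ × ℕ × ℕ × ℕ) (q : EPoly) :
    EPoly.toP3 (q.map fun t => (s.1 * t.1, s.2.1 + t.2.1, s.2.2.1 + t.2.2.1, s.2.2.2 + t.2.2.2)) =
      C (s.1 : ℝ) * (X 0 ^ s.2.1 * X 1 ^ s.2.2.1 * X 2 ^ s.2.2.2) * EPoly.toP3 q := by
  induction q with
  | nil => simp
  | cons t q ih =>
    rw [List.map_cons, toP3_cons, toP3_cons, ih, mul_add]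
    simp only [Rat.cast_mul, map_mul, pow_add]
    ring

/-- **The all-pairs product is multiplication.** -/
theorem toP3_mul (p q : EPoly) : EPoly.toP3 (EPoly.mul p q) = EPoly.toP3 p * EPoly.toP3 q := by
  induction p with
  | nil => simp [EPoly.mul]
  | cons s p ih =>
    have h : EPoly.mul (s :: p) q =
        (q.map fun t => (s.1 * t.1, s.2.1 + t.2.1, s.2.2.1 + t.2.2.1, s.2.2.2 + t.2.2.2)) ++ EPoly.mul p q := rfl
    rw [h, toP3_append, toP3_map_mulTerm, ih, toP3_cons, add_mul]

/-! ### Derivatives and multiplication by a variable -/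

/-- Every index of `Fin 3` is `0`, `1` or `2`. -/
private theorem fin3_cases (j : Fin 3) : j = 0 ∨ j = 1 ∨ j = 2 := by
  fin_cases j <;> simp

/-- **Partial derivatives**: the list derivative is `MvPolynomial.pderiv`. -/
theorem toP3_pderiv (j : Fin 3) (p : EPoly) : EPoly.toP3 (EPoly.pderiv j p) = pderiv j (EPoly.toP3 p) := by
  induction p with
  | nil => simp [EPoly.pderiv]
  | cons t p ih =>
    have h : EPoly.pderiv j (t :: p) =
        (if j = 0 then (t.1 * t.2.1, t.2.1 - 1, t.2.2.1, t.2.2.2)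
          else if j = 1 then (t.1 * t.2.2.1, t.2.1, t.2.2.1 - 1, t.2.2.2)
          else (t.1 * t.2.2.2, t.2.1, t.2.2.1, t.2.2.2 - 1)) :: EPoly.pderiv j p := rfl
    rw [h, toP3_cons, ih, toP3_cons, map_add, pderiv_C_mul]
    congr 1
    rcases fin3_cases j with rfl | rfl | rfl
    · have h1 : (1 : Fin 3) ≠ 0 := by decide
      have h2 : (2 : Fin 3) ≠ 0 := by decide
      simp only [if_true, pderiv_mul, pderiv_pow, pderiv_X_self, pderiv_X_of_ne h1, pderiv_X_of_ne h2,
        Rat.cast_mul, Rat.cast_natCast, map_mul, map_natCast, mul_zero, add_zero, mul_one]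
      ring
    · have h0 : (0 : Fin 3) ≠ 1 := by decide
      have h2 : (2 : Fin 3) ≠ 1 := by decide
      have h10 : ((1 : Fin 3) = 0) = False := by decide
      simp only [h10, if_false, if_true, pderiv_mul, pderiv_pow, pderiv_X_self, pderiv_X_of_ne h0,
        pderiv_X_of_ne h2, Rat.cast_mul, Rat.cast_natCast, map_mul, map_natCast, mul_zero, add_zero, zero_mul,
        zero_add, mul_one]
      ring
    · have h0 : (0 : Fin 3) ≠ 2 := by decide
      have h1 : (1 : Fin 3) ≠ 2 := by decide
      have h20 : ((2 : Fin 3) = 0) = False := by decide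
      have h21 : ((2 : Fin 3) = 1) = False := by decide
      simp only [h20, h21, if_false, pderiv_mul, pderiv_pow, pderiv_X_self, pderiv_X_of_ne h0,
        pderiv_X_of_ne h1, Rat.cast_mul, Rat.cast_natCast, map_mul, map_natCast, mul_zero, add_zero, zero_mul,
        zero_add, mul_one]
      ring

/-- **Multiplication by a variable.** -/
theorem toP3_mulX (j : Fin 3) (p : EPoly) : EPoly.toP3 (EPoly.mulX j p) = X j * EPoly.toP3 p := by
  induction p with
  | nil => simp [EPoly.mulX]
  | cons t p ih =>
    have h : EPoly.mulX j (t :: p) =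
        (if j = 0 then (t.1, t.2.1 + 1, t.2.2.1, t.2.2.2)
          else if j = 1 then (t.1, t.2.1, t.2.2.1 + 1, t.2.2.2)
          else (t.1, t.2.1, t.2.2.1, t.2.2.2 + 1)) :: EPoly.mulX j p := rfl
    rw [h, toP3_cons, ih, toP3_cons, mul_add]
    congr 1
    rcases fin3_cases j with rfl | rfl | rfl
    · simp only [if_true, pow_succ]
      ring
    · have h10 : ((1 : Fin 3) = 0) = False := by decide
      simp only [h10, if_false, if_true, pow_succ]
      ring
    · have h20 : ((2 : Fin 3) = 0) = False := by decide
      have h21 : ((2 : Fin 3) = 1) = False := by decide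
      simp only [h20, h21, if_false, pow_succ]
      ring

/-- **The conjugated derivative**: the list `dg` is the tree's `dg` on `P3`. -/
theorem toP3_dg (k : ℕ) (j : Fin 3) (p : EPoly) : EPoly.toP3 (EPoly.dg k j p) = dg k j (EPoly.toP3 p) := by
  rw [EPoly.dg, toP3_append, toP3_pderiv, toP3_smul, toP3_mulX, dg]
  simp only [Rat.cast_neg, Rat.cast_mul, Rat.cast_ofNat, Rat.cast_natCast, map_neg, map_mul, map_natCast, map_ofNat]
  ring

/-! ### Normal form -/

/-- Inserting a term adds its monomial. -/
theorem toP3_insertTerm (c : ℚ) (e : ℕ × ℕ × ℕ) (q : EPoly) :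
    EPoly.toP3 (EPoly.insertTerm c e q) = C (c : ℝ) * (X 0 ^ e.1 * X 1 ^ e.2.1 * X 2 ^ e.2.2) + EPoly.toP3 q := by
  induction q with
  | nil => rw [EPoly.insertTerm, toP3_single, toP3_nil, add_zero]
  | cons t q ih =>
    obtain ⟨c', e'⟩ := t
    rw [EPoly.insertTerm]
    by_cases h : e' = e
    · subst h
      rw [if_pos rfl, toP3_cons, toP3_cons, Rat.cast_add, map_add]
      ring
    · rw [if_neg h, toP3_cons, toP3_cons, ih]
      ring

/-- **Collecting equal exponents does not change the polynomial.** -/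
theorem toP3_collect (p : EPoly) : EPoly.toP3 (EPoly.collect p) = EPoly.toP3 p := by
  induction p with
  | nil => rfl
  | cons t p ih =>
    have h : EPoly.collect (t :: p) = EPoly.insertTerm t.1 t.2 (EPoly.collect p) := rfl
    rw [h, toP3_insertTerm, ih, toP3_cons]

/-- Dropping zero coefficients does not change the polynomial. -/
theorem toP3_filter_ne_zero (p : EPoly) : EPoly.toP3 (p.filter fun t => t.1 ≠ 0) = EPoly.toP3 p := by
  induction p with
  | nil => rfl
  | cons t p ih =>
    by_cases h : t.1 = 0
    · have hd : (t :: p).filter (fun t => t.1 ≠ 0) = p.filter (fun t => t.1 ≠ 0) := by simp [h]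
      rw [hd, ih, toP3_cons, h, Rat.cast_zero, map_zero, zero_mul, zero_add]
    · have hd : (t :: p).filter (fun t => t.1 ≠ 0) = t :: p.filter (fun t => t.1 ≠ 0) := by simp [h]
      rw [hd, toP3_cons, toP3_cons, ih]

/-- **The normal form does not change the polynomial.** -/
theorem toP3_norm (p : EPoly) : EPoly.toP3 (EPoly.norm p) = EPoly.toP3 p := by
  rw [EPoly.norm, toP3_filter_ne_zero, toP3_collect]

/-! ### Iterated conjugated derivatives, jets, products of jets -/

/-- Unfolding `EPoly.dgList` on `j :: l`. -/
theorem EPoly.dgList_cons (k : ℕ) (j : Fin 3) (l : List (Fin 3)) (p : EPoly) :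
    EPoly.dgList k (j :: l) p = EPoly.norm (EPoly.dg k j (EPoly.dgList k l p)) := rfl

/-- Unfolding `EPoly.dgList` on `[]`. -/
theorem EPoly.dgList_nil (k : ℕ) (p : EPoly) : EPoly.dgList k [] p = p := rfl

/-- **Iterated conjugated derivatives**: the list `dgList` is the tree's `dgList` on `P3`. -/
theorem toP3_dgList (k : ℕ) (l : List (Fin 3)) (p : EPoly) :
    EPoly.toP3 (EPoly.dgList k l p) = dgList k l (EPoly.toP3 p) := by
  induction l with
  | nil => rfl
  | cons j l ih => rw [EPoly.dgList_cons, toP3_norm, toP3_dg, ih, dgList_cons]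

/-- **Jets**: `toP3 (ejet P w) = dgList 1 w.2 (toP3 (P w.1))`. -/
theorem toP3_ejet (P : EField) (w : JVar) : EPoly.toP3 (ejet P w) = dgList 1 w.2 (EPoly.toP3 (P w.1)) :=
  toP3_dgList 1 w.2 (P w.1)

/-- The unit list is the polynomial `1`. -/
@[simp] theorem toP3_one : EPoly.toP3 [(1, 0, 0, 0)] = 1 := by
  rw [toP3_single]
  simp

/-- Unfolding `eprodJets` on `w :: ws`. -/
theorem eprodJets_cons (P : EField) (w : JVar) (ws : List JVar) :
    eprodJets P (w :: ws) = EPoly.norm (EPoly.mul (ejet P w) (eprodJets P ws)) := rfl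

/-- Unfolding `eprodJets` on `[]`. -/
theorem eprodJets_nil (P : EField) : eprodJets P [] = [(1, 0, 0, 0)] := rfl

/-- **Products of jets**: `toP3 (eprodJets P ws) = Π_{w ∈ ws} dgList 1 w.2 (toP3 (P w.1))`. -/
theorem toP3_eprodJets (P : EField) (ws : List JVar) :
    EPoly.toP3 (eprodJets P ws) = (ws.map fun w => dgList 1 w.2 (EPoly.toP3 (P w.1))).prod := by
  induction ws with
  | nil => rw [eprodJets_nil, toP3_one, List.map_nil, List.prod_nil]
  | cons w ws ih => rw [eprodJets_cons, toP3_norm, toP3_mul, toP3_ejet, ih, List.map_cons, List.prod_cons]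

/-! ### The Euler–Lagrange field -/

/-- The inner fold of `eEP` (over the positions of one monomial), generalised to an arbitrary list of positions and
an arbitrary accumulator. -/
private theorem toP3_eEP_inner (P : EField) (a : Fin 3) (t : ℤ × List JVar) (L : List (Fin t.2.length))
    (acc : EPoly) :
    EPoly.toP3 (L.foldr (fun s acc' =>
        let w := t.2.get s
        if w.1 = a then
          EPoly.norm (EPoly.smul ((-1 : ℚ) ^ w.2.length * (t.1 : ℚ))
            (EPoly.dgList 2 w.2 (eprodJets P (t.2.eraseIdx s))) ++ acc')
        else acc') acc) =
      (L.map fun s =>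
        if (t.2.get s).1 = a then
          C (((-1 : ℚ) ^ (t.2.get s).2.length * (t.1 : ℚ) : ℚ) : ℝ) *
            dgList 2 (t.2.get s).2 (((t.2.eraseIdx s).map fun w => dgList 1 w.2 (EPoly.toP3 (P w.1))).prod)
        else 0).sum + EPoly.toP3 acc := by
  induction L with
  | nil => rw [List.foldr_nil, List.map_nil, List.sum_nil, zero_add]
  | cons s L ih =>
    rw [List.foldr_cons, List.map_cons, List.sum_cons]
    by_cases h : (t.2.get s).1 = a
    · simp only [h, if_true]
      rw [toP3_norm, toP3_append, ih, toP3_smul, toP3_dgList, toP3_eprodJets, add_assoc]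
    · simp only [h, if_false]
      rw [ih, zero_add]

/-- Unfolding `eEP` on `[]`. -/
theorem eEP_nil (P : EField) (a : Fin 3) : eEP [] P a = [] := rfl

/-- Unfolding `eEP` on `t :: p`: one inner fold over the positions of the monomial of `t`. -/
theorem eEP_cons (t : ℤ × List JVar) (p : JPoly ℤ) (P : EField) (a : Fin 3) :
    eEP (t :: p) P a = (List.finRange t.2.length).foldr (fun s acc' =>
        let w := t.2.get s
        if w.1 = a then
          EPoly.norm (EPoly.smul ((-1 : ℚ) ^ w.2.length * (t.1 : ℚ))
            (EPoly.dgList 2 w.2 (eprodJets P (t.2.eraseIdx s))) ++ acc')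
        else acc') (eEP p P a) := rfl

/-- **The Euler–Lagrange field**: `toP3 (eEP p P a)` is the expected `P3` expression
`Σ_{terms (c, m)} Σ_{s : m_s = (a, l)} (−1)^{|l|} c · dgList 2 l (Π_{j ≠ s} dgList 1 (m_j).2 (toP3 (P (m_j).1)))`. -/
theorem toP3_eEP (p : JPoly ℤ) (P : EField) (a : Fin 3) :
    EPoly.toP3 (eEP p P a) =
      (p.map fun t => ((List.finRange t.2.length).map fun s =>
        if (t.2.get s).1 = a then
          C (((-1 : ℚ) ^ (t.2.get s).2.length * (t.1 : ℚ) : ℚ) : ℝ) *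
            dgList 2 (t.2.get s).2 (((t.2.eraseIdx s).map fun w => dgList 1 w.2 (EPoly.toP3 (P w.1))).prod)
        else 0).sum).sum := by
  induction p with
  | nil => rfl
  | cons t p ih => rw [eEP_cons, toP3_eEP_inner, ih, List.map_cons, List.sum_cons]

/-! ### `W = 2(v·∇)v`, divergences, the field of polynomials -/

/-- `toP3` of a `flatMap` is the sum of the `toP3`. -/
theorem toP3_flatMap {ι : Type*} (L : List ι) (f : ι → EPoly) :
    EPoly.toP3 (L.flatMap f) = (L.map fun i => EPoly.toP3 (f i)).sum := by
  induction L with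
  | nil => rfl
  | cons i L ih => rw [List.flatMap_cons, toP3_append, ih, List.map_cons, List.sum_cons]

/-- Components of `toP3v`. -/
@[simp] theorem toP3v_apply (P : EField) (i : Fin 3) : toP3v P i = EPoly.toP3 (P i) := rfl

/-- **`W = 2(v·∇)v`**: the list `eWP` is the tree's `WP`. -/
theorem toP3_eWP (P : EField) (i : Fin 3) : EPoly.toP3 (eWP P i) = WP (toP3v P) i := by
  rw [eWP, toP3_smul, toP3_flatMap, WP, Fin.sum_univ_def]
  simp only [toP3_mul, toP3_dg, toP3v_apply, Rat.cast_ofNat, map_ofNat]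

/-- **Divergences**: `toP3 (ediv k V) = Σᵢ dg k i (toP3 (V i))`. -/
theorem toP3_ediv (k : ℕ) (V : Fin 3 → EPoly) : EPoly.toP3 (ediv k V) = ∑ i, dg k i (EPoly.toP3 (V i)) := by
  rw [ediv, toP3_append, toP3_append, toP3_dg, toP3_dg, toP3_dg, Fin.sum_univ_three, add_assoc]

/-! ### Evaluation -/

/-- **Evaluation**: the real value of the list is the value of its polynomial. -/
theorem pev_toP3 (p : EPoly) (x : E3) : pev (EPoly.toP3 p) x = EPoly.eval p x := by
  induction p with
  | nil => simp [EPoly.eval]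
  | cons t p ih =>
    have h : EPoly.eval (t :: p) x = (t.1 : ℝ) * (x 0 ^ t.2.1 * x 1 ^ t.2.2.1 * x 2 ^ t.2.2.2) + EPoly.eval p x := by
      simp [EPoly.eval]
    rw [toP3_cons, pev_add, ih, h]
    simp

/-! ### The registered statement -/

/-- **Registered stub `epoly_semantics`** (refutation skeleton of `OddMorawetzLocal`, evaluator soundness 1/4): the
list polynomial vocabulary `EPoly` maps to `P3` homomorphically — evaluation, append, scalar multiples, products,
conjugated derivatives `dg`, normal form, iterated derivatives `dgList` — and the Euler–Lagrange list `eEP` is the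
expected `P3` expression. -/
theorem epoly_semantics :
    (∀ (p : EPoly) (x : E3), pev (EPoly.toP3 p) x = EPoly.eval p x) ∧
    (∀ p q : EPoly, EPoly.toP3 (p ++ q) = EPoly.toP3 p + EPoly.toP3 q) ∧
    (∀ (c : ℚ) (p : EPoly), EPoly.toP3 (EPoly.smul c p) = C (c : ℝ) * EPoly.toP3 p) ∧
    (∀ p q : EPoly, EPoly.toP3 (EPoly.mul p q) = EPoly.toP3 p * EPoly.toP3 q) ∧
    (∀ (k : ℕ) (j : Fin 3) (p : EPoly), EPoly.toP3 (EPoly.dg k j p) = dg k j (EPoly.toP3 p)) ∧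
    (∀ p : EPoly, EPoly.toP3 (EPoly.norm p) = EPoly.toP3 p) ∧
    (∀ (k : ℕ) (l : List (Fin 3)) (p : EPoly), EPoly.toP3 (EPoly.dgList k l p) = dgList k l (EPoly.toP3 p)) ∧
    (∀ (p : JPoly ℤ) (P : EField) (a : Fin 3), EPoly.toP3 (eEP p P a) =
      (p.map fun t => ((List.finRange t.2.length).map fun s =>
        if (t.2.get s).1 = a then
          C (((-1 : ℚ) ^ (t.2.get s).2.length * (t.1 : ℚ) : ℚ) : ℝ) *
            dgList 2 (t.2.get s).2 (((t.2.eraseIdx s).map fun w => dgList 1 w.2 (EPoly.toP3 (P w.1))).prod)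
        else 0).sum).sum) :=
  ⟨pev_toP3, toP3_append, toP3_smul, toP3_mul, toP3_dg, toP3_norm, toP3_dgList, toP3_eEP⟩

end Summit.NavierStokesRegularity.NavierStokesRegularity.Theorems.OddMorawetz
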